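import Summits.KontsevichZagierPeriods.Zeta5Search.Barrier.ConeGammaCritFarGamma

/-!
# ζ(5) search — BARRIER: THE FAR CRITICAL POINT THROUGH INFINITY — `Regular` as a CONCLUSION when the far interval
# avoids `z = 0` and the `λ₁`-value is separated from the far value

HONEST FRAMING (cell `pub-zeta5`): systematic search; no irrationality claim unless kernel-certified. MODEL objects under
Brown–Zudilin's (28)+(30) accounting ([BZ22] = arXiv:2210.03391; (28) observed, not proved). Theory seat cert-2 g38.

When the certified z-interval of the far root avoids `0` (so the box does NOT meet the stratum `{a₃ = 0}`) the zero
`z₁` of the reversed cubic is non-zero WITHOUT assuming `Regular`, `Y₁ = 1/z₁` is a root with `Q(Y₁) ≠ 0` (from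
`xDen ≠ 0`, `cubicQ_eq`) at which the twelve arguments of the growth functional are non-zero (g37's
`critFactors_far_ne_zero`) — an honest critical point by P2 g23's `isCritical_aOfS_of_root`; if moreover the `λ₁`-value
enclosure lies below the far one (`h₀ < l₁`), the three critical values are DISTINCT, so `Regular` HOLDS at every
direction of the box (`regular_aOfS_of_sepFarCheck`, `regular_of_sepFarCheck`) and the `γ`-bound of
`ConeGammaCritFarGamma` loses its `Regular` hypothesis (`gamma_le_of_sepFarCheck`). One computable test `sepFarCheck`
(Bool; definition lane). Nothing about the cone's supremum (C2 OPEN), S-E, (TD_A) or `ζ(5)`.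
-/

noncomputable section

open Set

namespace Summit.KontsevichZagierPeriods.Zeta5Search.Barrier.ConeGamma

namespace CritFar

open Literature.Analysis.ValidatedNumerics (AForm)
open Literature.Analysis.ValidatedNumerics.AForm
open LemmaFBox (SC SC_pos)
open CritBox

/-- The separation test: the `λ₁`-value enclosure lies strictly below the far value enclosure (`h₀ < l₁`) and the far
z-interval avoids `0` (`0 < zlo` or `zhi < 0`). -/
def sepFarCheck (D T : ℕ) (lo hi : List ℕ) (r0 : RootData) (fd : FarData) : Bool :=
  match rootCheck D T lo hi r0, farCheck D T lo hi fd with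
  | some (_, h0), some (l1, _) => decide (h0 < l1 ∧ (0 < fd.zlo ∨ fd.zhi < 0))
  | _, _ => false

/-- **`Regular` at every direction of the box** from `critFarCheck` + `sepFarCheck` (normalised direction). -/
theorem regular_aOfS_of_sepFarCheck {D T : ℕ} {lo hi : List ℕ} {r0 r2 : RootData} {fd : FarData}
    {c0lo c0hi c1hi : ℤ} {den : ℕ} (hc : critFarCheck D T lo hi r0 r2 fd c0lo c0hi c1hi den = true)
    (hs : sepFarCheck D T lo hi r0 fd = true) {t : Fin 8 → ℝ} (h : t ∈ LemmaFBox.box D lo hi) (ht0 : t 0 = 1) :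
    Regular (aOfS t) := by
  -- unpack the separation test together with the checker
  unfold sepFarCheck at hs
  unfold critFarCheck at hc
  split at hc
  swap
  · exact absurd hc (by simp)
  rename_i h0 l1 h1 l2 h2 hr0 hfc hr2
  rw [hr0, hfc] at hs
  simp only [decide_eq_true_eq] at hs
  obtain ⟨h01, hz0⟩ := hs
  simp only [Bool.and_eq_true, decide_eq_true_eq, nearSep] at hc
  obtain ⟨⟨⟨hok, hsep0⟩, hsep2⟩, hT, hden, hfar0, hfar2, hlen0, hlen2, h02, h12, _, _, _⟩ := hc
  have hopen := openBox_of_box hok h ht0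
  have h6 := hopen 5
  change 0 < t 6 ∧ t 6 < t 0 at h6
  have hSC : (0 : ℝ) < SC := by exact_mod_cast SC_pos
  -- near points
  obtain ⟨X0, Y0, hk0, hl0, hu0, _⟩ := exists_near_of_rootCheck hok hT h ht0 hfar0 hlen0 hr0
  obtain ⟨X2, Y2, hk2, hl2, hu2, _⟩ := exists_near_of_rootCheck hok hT h ht0 hfar2 hlen2 hr2
  clear hr0 hr2
  -- far check
  unfold farCheck at hfc
  split at hfc
  swap
  · exact absurd hfc (by simp)
  rename_i hfcond
  obtain ⟨⟨hzden, hzlt, hzlo, hzhi, hpieces, hsg⟩, hall⟩ := hfcond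
  simp only [Option.some.injEq, Prod.mk.injEq] at hfc
  obtain ⟨hl1, hh1v⟩ := hfc
  obtain ⟨z₁, hz₁, hrz⟩ := exists_revC_zero hok hT h ht0 hzden hzlt hzlo hzhi hsg
  clear hsg
  -- `z₁ ≠ 0` because the interval avoids `0`
  have hzd : (0 : ℝ) < fd.zden := by exact_mod_cast hzden
  have hz₁0 : z₁ ≠ 0 := by
    rcases hz0 with hpos | hneg
    · have : (0 : ℝ) < (fd.zlo : ℝ) / fd.zden := div_pos (by exact_mod_cast hpos) hzd
      exact (this.trans hz₁.1).ne'
    · have : (fd.zhi : ℝ) / fd.zden < 0 := div_neg_of_neg_of_pos (by exact_mod_cast hneg) hzd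
      exact (hz₁.2.trans this).ne
  have hroot1 : cubicC t z₁⁻¹ = 0 := by
    have := revC_eq t hz₁0
    rw [hrz] at this
    exact (mul_eq_zero.mp this.symm).resolve_left (pow_ne_zero 3 hz₁0)
  -- the piece and the far value form
  obtain ⟨j, hj, η, hη, hzj⟩ := exists_piece hzden hzlt hpieces hz₁
  obtain ⟨G, hG, hGl, hGh⟩ := pieceOK_sound (List.all_eq_true.mp hall j (List.mem_range.mpr hj))
  rw [hl1] at hGl; rw [hh1v] at hGh
  have hv := valid_noise hok h (show |(0 : ℝ)| ≤ 1 by simp) hη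
  set ε := noise D lo hi t 0 η with hε
  have htA := tAF_mem hok h ht0 (show |(0 : ℝ)| ≤ 1 by simp) hη
  have hzmem : mem SC ε z₁ (zPieceAF fd j) := by
    have hQ' : 0 < 2 * fd.pieces * fd.zden := Nat.mul_pos (Nat.mul_pos (by norm_num) hpieces) hzden
    have := coordAF_mem hv (2 * (fd.pieces : ℤ) * fd.zlo + (2 * (j : ℤ) + 1) * (fd.zhi - fd.zlo))
      [0, 0, 0, 0, 0, 0, 0] (fd.zhi - fd.zlo).toNat hQ' 9 (Or.inr rfl)
    have e9 : ε 9 = η := by simp [hε, noise]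
    rw [zPieceAF]
    convert this using 2
    rw [coordR, e9, hzj]
    simp [linR]
  obtain ⟨hD1, hnum1, hmem1⟩ := farValueAF_sound hv htA hzmem hG
  -- `Q(Y₁) ≠ 0`, the X-identity, and the far point IS a critical point
  set Y1 : ℝ := z₁⁻¹ with hY1
  have hY10 : Y1 ≠ 0 := inv_ne_zero hz₁0
  have hQ1 : cubicQ t Y1 ≠ 0 := by
    rw [cubicQ_eq t hY10, hY1, inv_inv]
    exact mul_ne_zero (pow_ne_zero 2 (inv_ne_zero hz₁0)) hD1
  obtain ⟨_, hx1⟩ := x_eq_of_root t hY10 hQ1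
  rw [hY1, inv_inv] at hx1
  have e1 : t 6 - Y1 + (t 6 - t 0) * cubicP t Y1 / cubicQ t Y1 = xNum t z₁ / xDen t z₁ + t 6 := by
    rw [hY1, ← hx1]; ring
  have e2 : Y1 + t 6 = z₁⁻¹ + t 6 := by rw [hY1]
  have hk1 : IsCritical (aOfS t) (t 6 - Y1 + (t 6 - t 0) * cubicP t Y1 / cubicQ t Y1) (Y1 + t 6) := by
    refine isCritical_aOfS_of_root (s := t) (P := cubicP t) (Q := cubicQ t) (C := cubicC t)
      (fun _ => rfl) (fun _ => rfl) (fun _ => rfl) hroot1 hQ1 ?_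
    intro k
    rw [e1, e2]
    exact critFactors_far_ne_zero t _ hz₁0 hnum1 k
  -- the three values
  set v0 := growthLogR (pR (aOfS t)) (qR (aOfS t)) (X0 + t 6) (Y0 + t 6) with hv0
  set v2 := growthLogR (pR (aOfS t)) (qR (aOfS t)) (X2 + t 6) (Y2 + t 6) with hv2
  set v1 := growthLogR (pR (aOfS t)) (qR (aOfS t)) (t 6 - Y1 + (t 6 - t 0) * cubicP t Y1 / cubicQ t Y1) (Y1 + t 6)
    with hv1
  have hv1eq : v1 = farSum t (xNum t z₁ / xDen t z₁) z₁ := by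
    rw [hv1, e1, e2, growthLogR_far t _ hz₁0 hnum1, farSum]
  have hl1' : ((l1 : ℤ) : ℝ) ≤ v1 * SC := by rw [hv1eq]; exact le_trans (by exact_mod_cast hGl) (lo_le hv hmem1)
  have hh1' : v1 * SC ≤ ((h1 : ℤ) : ℝ) := by rw [hv1eq]; exact le_trans (le_hi hv hmem1) (by exact_mod_cast hGh)
  have h01' : ((h0 : ℤ) : ℝ) < l1 := by exact_mod_cast h01
  have h12' : ((h1 : ℤ) : ℝ) < l2 := by exact_mod_cast h12
  have hv01 : v0 < v1 := lt_of_mul_lt_mul_right (by linarith : v0 * SC < v1 * SC) hSC.le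
  have hv12 : v1 < v2 := lt_of_mul_lt_mul_right (by linarith : v1 * SC < v2 * SC) hSC.le
  -- `critVals ⊇ {v0, v1, v2}` of size 3, and `≤ 3` ⇒ `= 3`
  have hmem : ∀ {x y : ℝ}, IsCritical (aOfS t) x y → growthLogR (pR (aOfS t)) (qR (aOfS t)) x y ∈ critVals (aOfS t) :=
    fun hk => ⟨_, _, hk, rfl⟩
  have hsub : ({v0, v1, v2} : Set ℝ) ⊆ critVals (aOfS t) := by
    intro v hv'
    simp only [Set.mem_insert_iff, Set.mem_singleton_iff] at hv'
    rcases hv' with rfl | rfl | rfl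
    · exact hmem hk0
    · exact hmem hk1
    · exact hmem hk2
  obtain ⟨hfin, hle⟩ := critVals_aOfS_finite_of_openBox hopen
  have hthree : ({v0, v1, v2} : Set ℝ).ncard = 3 :=
    Set.ncard_eq_three.mpr ⟨v0, v1, v2, hv01.ne, (hv01.trans hv12).ne, hv12.ne, rfl⟩
  have heq := Set.eq_of_subset_of_ncard_le hsub (by rw [hthree]; exact hle) hfin
  exact regular_of_critVals_eq_three heq.symm hv01.ne (hv01.trans hv12).ne hv12.ne

/-- **`Regular` on the box** (transfer): every direction `a` of the closed positive box whose normalised parameters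
lie in the box is `Regular`, when `critFarCheck` and `sepFarCheck` pass. -/
theorem regular_of_sepFarCheck {D T : ℕ} {lo hi : List ℕ} {r0 r2 : RootData} {fd : FarData}
    {c0lo c0hi c1hi : ℤ} {den : ℕ} (hc : critFarCheck D T lo hi r0 r2 fd c0lo c0hi c1hi den = true)
    (hs : sepFarCheck D T lo hi r0 fd = true) {a : Dir} (ha : BZBox a)
    (hbox : ∀ j : Fin 7, ((lo.getD j.succ 0 : ℕ) : ℝ) ≤ sParam a j.succ / sParam a 0 * D ∧
      sParam a j.succ / sParam a 0 * D ≤ ((hi.getD j.succ 0 : ℕ) : ℝ)) : Regular a := by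
  have hok := boxOKc_of_critFarCheck hc
  obtain ⟨hmem, ht0⟩ := normalise_mem_box hok ha hbox
  have hs0 : 0 < sParam a 0 := ha.1
  have hn := LemmaFBox.aOfS_normalise ha
  have eR : Regular a ↔ Regular (aOfS fun i => sParam a i / sParam a 0) := by
    conv_lhs => rw [hn]
    exact regular_smul hs0 _
  exact eR.2 (regular_aOfS_of_sepFarCheck hc hs hmem ht0)

/-- **`γ ≤ γ_box` WITHOUT the `Regular` hypothesis** when the separation test passes (then `Regular` is proved on
the box). Box hypothesis explicit; MODEL `gamma`; an upper bound over the box; nothing about the cone's supremum. -/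
theorem gamma_le_of_sepFarCheck {D T : ℕ} {lo hi : List ℕ} {r0 r2 : RootData} {fd : FarData}
    {c0lo c0hi c1hi : ℤ} {den : ℕ} (hc : critFarCheck D T lo hi r0 r2 fd c0lo c0hi c1hi den = true)
    (hs : sepFarCheck D T lo hi r0 fd = true) {s5 : Fin 5 → Fin 28} {p : ℤ} {q gnum gden : ℕ}
    (hg : gammaCheck D lo hi s5 c0lo c1hi den p q gnum gden = true)
    (hΦ : ∀ a : Dir, BZBox a →
      (∀ j : Fin 7, ((lo.getD j.succ 0 : ℕ) : ℝ) ≤ sParam a j.succ / sParam a 0 * D ∧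
        sParam a j.succ / sParam a 0 * D ≤ ((hi.getD j.succ 0 : ℕ) : ℝ)) → phi30 a ≤ sParam a 0 * ((p : ℝ) / q))
    {a : Dir} (ha : BZBox a)
    (hbox : ∀ j : Fin 7, ((lo.getD j.succ 0 : ℕ) : ℝ) ≤ sParam a j.succ / sParam a 0 * D ∧
      sParam a j.succ / sParam a 0 * D ≤ ((hi.getD j.succ 0 : ℕ) : ℝ)) :
    gamma a ≤ (gnum : ℝ) / gden :=
  gamma_le_of_critFarCheck hc hg hΦ ha hbox (regular_of_sepFarCheck hc hs ha hbox)

end CritFar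

end Summit.KontsevichZagierPeriods.Zeta5Search.Barrier.ConeGamma

end
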